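import Mathlib
import Summits.QuantumAdvantage.QuantumAdvantage.Theorems.MobiusLadderQuadraticDigitPhasesStubOneCutKataiDigits
import Summits.QuantumAdvantage.QuantumAdvantage.Theorems.MobiusLadderQuadraticDigitPhasesStubOneCutKataiCS

/-!
# One cut of high rank (`stub_oneCutKatai`)

Stub `stub_oneCutKatai` of the crux `MobiusLadder.QuadraticDigitPhases` (stmt-QuantumAdvantage-1391),
line `Sketch`: the λ-free heart of the HIGH branch.  For distinct odd primes `p, q ≤ B`, a quadratic
`P` over `𝔽₂` in the `n` binary digits, and a digit cut `c` whose cross-coefficient matrix has rank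
`≥ R₀(B, τ, hDWD)`, the Kátai pair sum `Σ_{m ≤ M} (-1)^{P(bits(pm)) + P(bits(qm))}` is `≤ τ M` on
`M ∈ [2^n/(2B), 2^n]`, GIVEN the Walsh–dilation decay `hDWD` (masks of joint size `≥ w` have correlation
`≤ δ 2^c` along `T ↦ (pT, qT)` on intervals below `2^c`) and the sparse-image count `hCount`.

The computation: `m = 2^c T + T₀`; the digits of `p m` are `bits_{<c}(p T₀)` and
`bits_d(p T + ⌊p T₀/2^c⌋)` (`d = n - c`); `P = P₀(x_{<c}) + P₁(x_{≥c}) + x_{<c}ᵀ Bc x_{≥c}`; so on the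
carry class of `T₀` (an interval; `≤ pq` classes) the summand is `ε₀(T₀) · s(T) · (-1)^{⟨u₀(T₀), Bc U(T)⟩ +
⟨v₀(T₀), Bc V(T)⟩}`.  Taking `|·|` in `T₀` and Cauchy–Schwarz over each class leaves pair sums
`K(T,T') = Σ_{T₀} (-1)^{⟨u₀, Bc(U T + U T')⟩ + ⟨v₀, Bc(V T + V T')⟩}` = Walsh–dilation correlations with
masks `supp Bc ξ`, `supp Bc ζ`: `≤ δ 2^c` for good pairs, and the bad pairs (`|supp Bc ξ| < w`) number
`≤ T_max (w r + 1)^w 2^{d - r}` by `hCount` on the injective image `{U T}` (`p` odd, `T_max ≤ 2^d`).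
With `δ = τ²/(8B⁴)`, `(w r + 1)^w ≤ τ² 2^r/(32 B⁵)` (`r ≥ R₁`) and `2^r ≥ 16B/τ + 4B` (`r ≥ R₂`), the
main term is `≤ τM/2` and the boundary `2^c + 1 ≤ 3τM/8`.
-/

set_option linter.dupNamespace false -- D-0017: single-problem summit ⇒ QuantumAdvantage.QuantumAdvantage by design

namespace Summit.QuantumAdvantage.QuantumAdvantage.Theorems.MobiusLadderQuadraticDigitPhasesStubOneCutKatai

open Finset

/-! ## The sign of `P` on one block, factored along the cut -/

/-- On the block `m = 2^c T + T₀` the sign `(-1)^{P(bits(p m))}` factors as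
`(-1)^{P₀(u₀)} (-1)^{P₁(u₁)} (-1)^{⟨u₀, Bc u₁⟩}` with `u₀ = bits_{<c}(p T₀)`, `u₁ = bits_d(p T + ⌊pT₀/2^c⌋)`. -/
theorem sign_eval_block {c d : ℕ} (P : MvPolynomial (Fin (c + d)) (ZMod 2))
    (Bc : Matrix (Fin c) (Fin d) (ZMod 2)) (P₀ : (Fin c → ZMod 2) → ZMod 2)
    (P₁ : (Fin d → ZMod 2) → ZMod 2)
    (hsplit : ∀ x : Fin (c + d) → ZMod 2, (∀ i, x i * x i = x i) →
        MvPolynomial.eval x P = P₀ (fun i => x (Fin.castAdd d i)) + P₁ (fun k => x (Fin.natAdd c k)) +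
          ∑ i : Fin c, x (Fin.castAdd d i) * (Bc.mulVec (fun k => x (Fin.natAdd c k))) i)
    (p T T₀ : ℕ) :
    (if MvPolynomial.eval (fun i : Fin (c + d) =>
          if Nat.testBit (p * (2 ^ c * T + T₀)) i then (1 : ZMod 2) else 0) P = 1
        then (-1 : ℝ) else 1) =
      (if P₀ (fun i : Fin c => if Nat.testBit (p * T₀) i then 1 else 0) = 1 then (-1 : ℝ) else 1) *
      (if P₁ (fun k : Fin d => if Nat.testBit (p * T + p * T₀ / 2 ^ c) k then 1 else 0) = 1
        then (-1 : ℝ) else 1) *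
      (if (fun i : Fin c => if Nat.testBit (p * T₀) i then (1 : ZMod 2) else 0) ⬝ᵥ
            Bc.mulVec (fun k : Fin d => if Nat.testBit (p * T + p * T₀ / 2 ^ c) k then 1 else 0) = 1
        then (-1 : ℝ) else 1) := by
  rw [hsplit _ (fun i => by split_ifs <;> simp)]
  have hlo : ∀ i : Fin c, (if Nat.testBit (p * (2 ^ c * T + T₀)) ((Fin.castAdd d i : Fin (c + d)) : ℕ)
      then (1 : ZMod 2) else 0) = if Nat.testBit (p * T₀) i then 1 else 0 := by
    intro i
    rw [Fin.val_castAdd, testBit_mul_block, if_pos i.isLt]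
  have hhi : ∀ k : Fin d, (if Nat.testBit (p * (2 ^ c * T + T₀)) ((Fin.natAdd c k : Fin (c + d)) : ℕ)
      then (1 : ZMod 2) else 0) = if Nat.testBit (p * T + p * T₀ / 2 ^ c) k then 1 else 0 := by
    intro k
    rw [Fin.val_natAdd, testBit_mul_block, if_neg (show ¬ (c + (k : ℕ) < c) by omega),
      Nat.add_sub_cancel_left]
  simp only [hlo, hhi]
  rw [sign_add, sign_add]
  rfl

/-! ## Arithmetic of the constants -/

/-- The class inequality: from `S² ≤ L · L · (T² δ + T X Y)` with `δ = τ²/(8B⁴)`,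
`X Y ≤ τ² D/(32 B⁵)` and `D ≤ 4 B T` conclude `S ≤ L T τ/(2B²)`. -/
theorem numeric_class {L Tm B τ δ X Y D S : ℝ} (hL : 0 ≤ L) (hTm : 0 ≤ Tm) (hB : 0 < B) (hτ : 0 < τ)
    (hδ : δ = τ ^ 2 / (8 * B ^ 4)) (hXY : X * Y ≤ τ ^ 2 / (32 * B ^ 5) * D) (hD : D ≤ 4 * B * Tm)
    (hSsq : S ^ 2 ≤ L * (L * (Tm ^ 2 * δ + Tm * X * Y))) :
    S ≤ L * Tm * τ / (2 * B ^ 2) := by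
  have h1 : Tm * X * Y ≤ Tm ^ 2 * (τ ^ 2 / (8 * B ^ 4)) := by
    have h2 : X * Y ≤ τ ^ 2 / (32 * B ^ 5) * (4 * B * Tm) :=
      hXY.trans (mul_le_mul_of_nonneg_left hD (by positivity))
    have h3 : τ ^ 2 / (32 * B ^ 5) * (4 * B * Tm) = Tm * (τ ^ 2 / (8 * B ^ 4)) := by
      field_simp
      ring
    calc Tm * X * Y = Tm * (X * Y) := by ring
      _ ≤ Tm * (Tm * (τ ^ 2 / (8 * B ^ 4))) := mul_le_mul_of_nonneg_left (h3 ▸ h2) hTm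
      _ = _ := by ring
  have h4 : S ^ 2 ≤ (L * Tm * τ / (2 * B ^ 2)) ^ 2 := by
    calc S ^ 2 ≤ L * (L * (Tm ^ 2 * δ + Tm * X * Y)) := hSsq
      _ ≤ L * (L * (Tm ^ 2 * (τ ^ 2 / (8 * B ^ 4)) + Tm ^ 2 * (τ ^ 2 / (8 * B ^ 4)))) := by
          rw [hδ]
          exact mul_le_mul_of_nonneg_left (mul_le_mul_of_nonneg_left (by linarith) hL) hL
      _ = (L * Tm * τ / (2 * B ^ 2)) ^ 2 := by
          field_simp
          ring
  have h5 : 0 ≤ L * Tm * τ / (2 * B ^ 2) := by positivity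
  exact (le_abs_self S).trans (abs_le_of_sq_le_sq h4 h5)

/-- The final bookkeeping: main term `≤ τM/2`, boundary `L + 1 ≤ τM/8 + τM/4`. -/
theorem numeric_final {S A L Tm M B τ D pq : ℝ} (hB : 0 < B) (hτ : 0 < τ) (hL1 : 1 ≤ L)
    (hTm : 0 ≤ Tm) (hS : S ≤ A + L + 1) (hA : A ≤ pq * (L * Tm * τ / (2 * B ^ 2)))
    (hpq : pq ≤ B ^ 2) (hLTm : L * Tm ≤ M) (hLD : L * D ≤ 2 * B * M)
    (hτD : 16 * B ≤ τ * D) (hD : D ≤ 4 * B * Tm) : S ≤ τ * M := by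
  have ht : 0 ≤ L * Tm * τ / (2 * B ^ 2) := by positivity
  have hA' : A ≤ τ * M / 2 := by
    calc A ≤ pq * (L * Tm * τ / (2 * B ^ 2)) := hA
      _ ≤ B ^ 2 * (L * Tm * τ / (2 * B ^ 2)) := mul_le_mul_of_nonneg_right hpq ht
      _ = (L * Tm) * τ / 2 := by
          field_simp
      _ ≤ M * τ / 2 := by gcongr
      _ = τ * M / 2 := by ring
  have h8L : 8 * L ≤ τ * M := by
    have h1 : 16 * B * L ≤ τ * D * L := mul_le_mul_of_nonneg_right hτD (by linarith)
    have h2 : τ * (L * D) ≤ τ * (2 * B * M) := mul_le_mul_of_nonneg_left hLD hτ.le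
    have h3 : 2 * B * (8 * L) ≤ 2 * B * (τ * M) := by nlinarith
    exact le_of_mul_le_mul_left h3 (by positivity)
  have h4 : 4 ≤ τ * M := by
    have h1 : 16 * B ≤ τ * (4 * B * Tm) := hτD.trans (mul_le_mul_of_nonneg_left hD hτ.le)
    have h2 : 4 * B * 4 ≤ 4 * B * (τ * Tm) := by nlinarith
    have h3 : 4 ≤ τ * Tm := le_of_mul_le_mul_left h2 (by positivity)
    have h5 : Tm ≤ M := by nlinarith
    nlinarith
  nlinarith

/-! ## The stub -/

/-- Helper: the `ZMod 2`-valued indicator of a bit determines the bit. -/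
theorem bool_eq_of_indicator_eq {b b' : Bool}
    (h : (if b then (1 : ZMod 2) else 0) = (if b' then (1 : ZMod 2) else 0)) : b = b' := by
  revert h
  cases b <;> cases b' <;> simp

/-- STUB `stub_oneCutKatai` of the line `Sketch` (crux `MobiusLadder.QuadraticDigitPhases`) — ONE CUT OF
HIGH RANK.  If some digit cut `c` of the quadratic `P` has cross-coefficient matrix of rank `≥ R₀`
(`R₀` depending on `B, τ` and on the Walsh–dilation thresholds `hDWD`), then the Kátai pair sum
`Σ_{m ≤ M} (-1)^{P(bits(pm)) + P(bits(qm))}` is `≤ τ M` for `M ∈ [2^n/(2B), 2^n]`.  Proof: write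
`m = 2^c T + T₀`; the digits of `p m` are `(bits_{<c}(p T₀), bits(p T + ⌊pT₀/2^c⌋))`, and
`P = P₀(x_{<c}) + P₁(x_{≥c}) + x_{<c}ᵀ Bc x_{≥c}`; split `T₀` into the `≤ pq` carry classes (intervals),
take `|·|` in `T₀` (kills `P₀`) and Cauchy–Schwarz over each class (kills `P₁`); the expanded square
is a sum over pairs `(T, T')` of Walsh–dilation correlations with masks `supp Bc(U T + U T')`:
good pairs are `≤ δ 2^c` by `hDWD`, bad pairs are few by `hCount` applied to the injective image
`{U T : T < T_max}` (`p` odd, `T_max ≤ 2^{n-c}`), with `rank Bc ≥ R₀` and `T_max ≥ 2^{n-c}/(4B)`. -/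
theorem stub_oneCutKatai :
    ∀ p q B : ℕ, p.Prime → q.Prime → p ≠ q → 2 < p → 2 < q → p ≤ B → q ≤ B →
      (∀ δ : ℝ, 0 < δ → ∃ w : ℕ, ∀ c : ℕ, ∀ A B : Finset (Fin c), w ≤ (A ∪ B).card →
        ∀ a b : ℕ, b ≤ 2 ^ c →
          |∑ T ∈ Ico a b, (∏ i ∈ A, (if Nat.testBit (p * T) i then (-1 : ℝ) else 1)) *
              (∏ i ∈ B, (if Nat.testBit (q * T) i then (-1 : ℝ) else 1))| ≤ δ * (2 : ℝ) ^ c) →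
      (∀ (c d : ℕ) (B : Matrix (Fin c) (Fin d) (ZMod 2)) (w : ℕ) (S : Finset (Fin d → ZMod 2)),
        (((S ×ˢ S).filter (fun xy =>
            ((Finset.univ.filter fun i : Fin c => (B.mulVec (xy.1 - xy.2)) i ≠ 0).card < w))).card : ℝ) ≤
          S.card * ((w * B.rank + 1 : ℕ) : ℝ) ^ w * (2 : ℝ) ^ (d - B.rank)) →
      ∀ τ : ℝ, 0 < τ → ∃ R₀ : ℕ, ∀ n : ℕ, ∀ P : MvPolynomial (Fin n) (ZMod 2), P.totalDegree ≤ 2 →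
        ∀ c : ℕ, R₀ ≤ (Matrix.of fun (i j : Fin n) =>
            if (i : ℕ) < c ∧ c ≤ (j : ℕ) then
              MvPolynomial.coeff (Finsupp.single i 1 + Finsupp.single j 1) P else 0).rank →
      ∀ M : ℕ, M ≤ 2 ^ n → 2 ^ n ≤ 2 * B * M →
        |∑ m ∈ Icc 1 M,
          (if MvPolynomial.eval (fun i : Fin n => if Nat.testBit (p * m) i then (1 : ZMod 2) else 0) P = 1
            then (-1 : ℝ) else 1) *
          (if MvPolynomial.eval (fun i : Fin n => if Nat.testBit (q * m) i then (1 : ZMod 2) else 0) P = 1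
            then (-1 : ℝ) else 1)| ≤ τ * M := by
  intro p q B hp hq hpq hp2 hq2 hpB hqB hDWD hCount τ hτ
  classical
  -- the constants
  have hB3 : (3 : ℝ) ≤ B := by exact_mod_cast (show 3 ≤ B by omega)
  have hBpos : (0 : ℝ) < B := by linarith
  set δ : ℝ := τ ^ 2 / (8 * (B : ℝ) ^ 4) with hδ
  have hδpos : 0 < δ := by positivity
  obtain ⟨w, hw⟩ := hDWD δ hδpos
  have hηpos : (0 : ℝ) < τ ^ 2 / (32 * (B : ℝ) ^ 5) := by positivity
  obtain ⟨R₁, hR₁⟩ := exists_pow_le_two_pow w hηpos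
  obtain ⟨R₂, hR₂⟩ := pow_unbounded_of_one_lt (16 * (B : ℝ) / τ + 4 * B) (one_lt_two (α := ℝ))
  refine ⟨R₁ + R₂ + 1, ?_⟩
  intro n P hP c hrank M hM hBM
  -- `c ≤ n`, and `n = c + d`
  have hcn : c ≤ n := by
    by_contra hlt
    push Not at hlt
    have hzero : (Matrix.of fun (i j : Fin n) => if (i : ℕ) < c ∧ c ≤ (j : ℕ) then
        MvPolynomial.coeff (Finsupp.single i 1 + Finsupp.single j 1) P else 0) = 0 := by
      ext i j
      simp only [Matrix.of_apply, Matrix.zero_apply]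
      rw [if_neg]
      intro h
      have := j.isLt
      omega
    rw [hzero, Matrix.rank_zero] at hrank
    omega
  obtain ⟨d, rfl⟩ : ∃ d, n = c + d := ⟨n - c, by omega⟩
  -- the cut block and its rank
  set Bc : Matrix (Fin c) (Fin d) (ZMod 2) := Matrix.of fun i k =>
    MvPolynomial.coeff (Finsupp.single (Fin.castAdd d i) 1 + Finsupp.single (Fin.natAdd c k) 1) P
    with hBc
  have hrankBc : R₁ + R₂ + 1 ≤ Bc.rank :=
    hrank.trans (rank_padded_le c d
      (fun i j => MvPolynomial.coeff (Finsupp.single i 1 + Finsupp.single j 1) P) Bc (fun i k => rfl))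
  set r : ℕ := Bc.rank with hr
  have hrd : r ≤ d := Matrix.rank_le_width Bc
  have hR₁r : R₁ ≤ r := by omega
  have hR₂d : R₂ ≤ d := by omega
  -- the split of `P`
  obtain ⟨P₀, P₁, hsplitP⟩ := eval_split P hP Bc (fun i k => rfl)
  -- notation: signs, digit vectors, the summand
  set sg : ZMod 2 → ℝ := fun e => if e = 1 then (-1 : ℝ) else 1 with hsg
  set u₀ : ℕ → Fin c → ZMod 2 := fun T₀ i => if Nat.testBit (p * T₀) i then 1 else 0 with hu₀
  set v₀ : ℕ → Fin c → ZMod 2 := fun T₀ i => if Nat.testBit (q * T₀) i then 1 else 0 with hv₀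
  set U : ℕ → ℕ → Fin d → ZMod 2 := fun k₁ T k => if Nat.testBit (p * T + k₁) k then 1 else 0 with hU
  set V : ℕ → ℕ → Fin d → ZMod 2 := fun k₂ T k => if Nat.testBit (q * T + k₂) k then 1 else 0 with hV
  set ε₀ : ℕ → ℝ := fun T₀ => sg (P₀ (u₀ T₀)) * sg (P₀ (v₀ T₀)) with hε₀
  set s : ℕ → ℕ → ℕ → ℝ := fun k₁ k₂ T => sg (P₁ (U k₁ T)) * sg (P₁ (V k₂ T)) with hs
  set Tm : ℕ := M / 2 ^ c with hTm
  set g : ℕ × ℕ → ℕ → ℝ := fun κ T₀ => ∑ T ∈ range Tm, s κ.1 κ.2 T *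
    sg (u₀ T₀ ⬝ᵥ Bc.mulVec (U κ.1 T) + v₀ T₀ ⬝ᵥ Bc.mulVec (V κ.2 T)) with hg
  set F : ℕ → ℝ := fun m =>
    (if MvPolynomial.eval (fun i : Fin (c + d) => if Nat.testBit (p * m) i then (1 : ZMod 2) else 0) P = 1
      then (-1 : ℝ) else 1) *
    (if MvPolynomial.eval (fun i : Fin (c + d) => if Nat.testBit (q * m) i then (1 : ZMod 2) else 0) P = 1
      then (-1 : ℝ) else 1) with hF
  change |∑ m ∈ Icc 1 M, F m| ≤ τ * M
  -- elementary bounds on the signs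
  have hsg1 : ∀ e, |sg e| = 1 := fun e => abs_sign e
  have hF1 : ∀ m, |F m| ≤ 1 := by
    intro m
    simp only [hF]
    rw [abs_mul, abs_sign, abs_sign]
    norm_num
  have hε₀1 : ∀ T₀, |ε₀ T₀| ≤ 1 := by
    intro T₀
    simp only [hε₀]
    rw [abs_mul, hsg1, hsg1]
    norm_num
  have hs1 : ∀ k₁ k₂ T, |s k₁ k₂ T| ≤ 1 := by
    intro k₁ k₂ T
    simp only [hs]
    rw [abs_mul, hsg1, hsg1]
    norm_num
  -- the factorisation on blocks
  have hFT : ∀ T₀ T, F (2 ^ c * T + T₀) = ε₀ T₀ * (s (p * T₀ / 2 ^ c) (q * T₀ / 2 ^ c) T *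
      sg (u₀ T₀ ⬝ᵥ Bc.mulVec (U (p * T₀ / 2 ^ c) T) + v₀ T₀ ⬝ᵥ Bc.mulVec (V (q * T₀ / 2 ^ c) T))) := by
    intro T₀ T
    simp only [hF, hε₀, hs, hsg, hu₀, hv₀, hU, hV]
    rw [sign_eval_block P Bc P₀ P₁ hsplitP p T T₀, sign_eval_block P Bc P₀ P₁ hsplitP q T T₀, sign_add]
    ring
  have hT₀bound : ∀ T₀, |∑ T ∈ range Tm, F (2 ^ c * T + T₀)| ≤
      |g (p * T₀ / 2 ^ c, q * T₀ / 2 ^ c) T₀| := by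
    intro T₀
    have heq : ∑ T ∈ range Tm, F (2 ^ c * T + T₀) = ε₀ T₀ * g (p * T₀ / 2 ^ c, q * T₀ / 2 ^ c) T₀ := by
      simp only [hg]
      rw [Finset.mul_sum]
      exact Finset.sum_congr rfl (fun T _ => by rw [hFT T₀ T])
    rw [heq, abs_mul]
    exact mul_le_of_le_one_left (abs_nonneg _) (hε₀1 T₀)
  -- injectivity of `T ↦ U k₁ T` on `[0, T_max)`
  have hpodd : Odd p := hp.odd_of_ne_two (by omega)
  have hTm2d : Tm ≤ 2 ^ d := by
    have h1 : 2 ^ (c + d) / 2 ^ c = 2 ^ d := by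
      rw [Nat.pow_add, Nat.mul_div_cancel_left _ (by positivity)]
    rw [hTm, ← h1]
    exact Nat.div_le_div_right hM
  have hUinj : ∀ k₁, ∀ T ∈ range Tm, ∀ T' ∈ range Tm, U k₁ T = U k₁ T' → T = T' := by
    intro k₁ T hT T' hT' hUU
    rw [Finset.mem_range] at hT hT'
    refine eq_of_testBit_mul_add_eq (κ := k₁) hpodd (lt_of_lt_of_le hT hTm2d)
      (lt_of_lt_of_le hT' hTm2d) (fun k hk => ?_)
    have := congrFun hUU ⟨k, hk⟩
    simp only [hU] at this
    exact bool_eq_of_indicator_eq this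
  -- real-number facts about `T_max`, `2^d`
  have hL1 : (1 : ℝ) ≤ (2 : ℝ) ^ c := one_le_pow₀ (by norm_num)
  have hLpos : (0 : ℝ) < (2 : ℝ) ^ c := by positivity
  have hLTm : (2 : ℝ) ^ c * Tm ≤ M := by
    have := Nat.mul_div_le M (2 ^ c)
    rw [hTm]
    exact_mod_cast this
  have hLD : (2 : ℝ) ^ c * (2 : ℝ) ^ d ≤ 2 * B * M := by
    rw [← pow_add]
    exact_mod_cast hBM
  have hR₂d' : (2 : ℝ) ^ R₂ ≤ (2 : ℝ) ^ d := pow_le_pow_right₀ (by norm_num) hR₂d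
  have hτD : 16 * (B : ℝ) ≤ τ * (2 : ℝ) ^ d := by
    have h1 : 16 * (B : ℝ) / τ ≤ (2 : ℝ) ^ d := by
      have : (0 : ℝ) ≤ 4 * B := by positivity
      linarith
    rw [div_le_iff₀ hτ] at h1
    linarith
  have h4B : 4 * (B : ℝ) ≤ (2 : ℝ) ^ d := by
    have : (0 : ℝ) ≤ 16 * B / τ := by positivity
    linarith
  have hD : (2 : ℝ) ^ d ≤ 4 * B * Tm := by
    have h1 : (M : ℝ) + 1 ≤ (2 : ℝ) ^ c * (Tm + 1) := by
      have := Nat.lt_mul_div_succ M (show 0 < 2 ^ c by positivity)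
      rw [hTm]
      exact_mod_cast this
    have h2 : (2 : ℝ) ^ c * (2 : ℝ) ^ d ≤ (2 : ℝ) ^ c * (2 * B * (Tm + 1)) := by nlinarith
    have h3 : (2 : ℝ) ^ d ≤ 2 * B * (Tm + 1) := le_of_mul_le_mul_left h2 hLpos
    nlinarith
  -- the class estimate
  have hclass : ∀ κ : ℕ × ℕ,
      ∑ T₀ ∈ (range (2 ^ c)).filter (fun T₀ => (p * T₀ / 2 ^ c, q * T₀ / 2 ^ c) = κ),
        |g (p * T₀ / 2 ^ c, q * T₀ / 2 ^ c) T₀| ≤ (2 : ℝ) ^ c * Tm * τ / (2 * (B : ℝ) ^ 2) := by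
    intro κ
    obtain ⟨a, b, hb, hab⟩ := carryClass_eq_Ico p q (2 ^ c) (2 ^ c) κ
    have hrew : ∑ T₀ ∈ (range (2 ^ c)).filter (fun T₀ => (p * T₀ / 2 ^ c, q * T₀ / 2 ^ c) = κ),
        |g (p * T₀ / 2 ^ c, q * T₀ / 2 ^ c) T₀| = ∑ T₀ ∈ Ico a b, |g κ T₀| := by
      rw [← hab]
      exact Finset.sum_congr rfl (fun T₀ hT₀ => by rw [(Finset.mem_filter.mp hT₀).2])
    rw [hrew]
    have hsq := class_sq_bound Bc p q hδpos.le w (hw c) (hCount c d Bc w) (a := a) hb Tm (U κ.1) (V κ.2)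
      (hUinj κ.1) (s κ.1 κ.2) (hs1 κ.1 κ.2) u₀ v₀ (fun _ _ => rfl) (fun _ _ => rfl) (g κ) (fun _ => rfl)
    have hXY : (((w * Bc.rank + 1 : ℕ) : ℝ) ^ w) * (2 : ℝ) ^ (d - Bc.rank) ≤
        τ ^ 2 / (32 * (B : ℝ) ^ 5) * (2 : ℝ) ^ d := by
      have h1 := hR₁ r hR₁r
      have h2 : (2 : ℝ) ^ r * (2 : ℝ) ^ (d - r) = (2 : ℝ) ^ d := by
        rw [← pow_add, Nat.add_sub_cancel' hrd]
      calc (((w * r + 1 : ℕ) : ℝ) ^ w) * (2 : ℝ) ^ (d - r)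
          ≤ (τ ^ 2 / (32 * (B : ℝ) ^ 5) * (2 : ℝ) ^ r) * (2 : ℝ) ^ (d - r) :=
            mul_le_mul_of_nonneg_right h1 (by positivity)
        _ = _ := by rw [mul_assoc, h2]
    refine numeric_class (S := ∑ T₀ ∈ Ico a b, |g κ T₀|) hLpos.le (Nat.cast_nonneg Tm) hBpos hτ hδ
      hXY hD ?_
    calc (∑ T₀ ∈ Ico a b, |g κ T₀|) ^ 2
        ≤ (2 : ℝ) ^ c * ((2 : ℝ) ^ c * ((Tm : ℝ) ^ 2 * δ +
            Tm * ((w * Bc.rank + 1 : ℕ) : ℝ) ^ w * (2 : ℝ) ^ (d - Bc.rank))) := hsq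
      _ = _ := by ring
  -- summing the classes
  have hmaps : ∀ T₀ ∈ range (2 ^ c), (p * T₀ / 2 ^ c, q * T₀ / 2 ^ c) ∈ range p ×ˢ range q := by
    intro T₀ hT₀
    rw [Finset.mem_range] at hT₀
    simp only [Finset.mem_product, Finset.mem_range]
    have h2c : 0 < 2 ^ c := by positivity
    constructor
    · rw [Nat.div_lt_iff_lt_mul h2c]
      exact Nat.mul_lt_mul_of_pos_left hT₀ (by omega)
    · rw [Nat.div_lt_iff_lt_mul h2c]
      exact Nat.mul_lt_mul_of_pos_left hT₀ (by omega)
  have hmain : |∑ T ∈ range Tm, ∑ T₀ ∈ range (2 ^ c), F (2 ^ c * T + T₀)| ≤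
      ((p * q : ℕ) : ℝ) * ((2 : ℝ) ^ c * Tm * τ / (2 * (B : ℝ) ^ 2)) := by
    rw [Finset.sum_comm]
    calc |∑ T₀ ∈ range (2 ^ c), ∑ T ∈ range Tm, F (2 ^ c * T + T₀)|
        ≤ ∑ T₀ ∈ range (2 ^ c), |∑ T ∈ range Tm, F (2 ^ c * T + T₀)| := Finset.abs_sum_le_sum_abs _ _
      _ ≤ ∑ T₀ ∈ range (2 ^ c), |g (p * T₀ / 2 ^ c, q * T₀ / 2 ^ c) T₀| :=
          Finset.sum_le_sum (fun T₀ _ => hT₀bound T₀)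
      _ = ∑ κ ∈ range p ×ˢ range q,
            ∑ T₀ ∈ (range (2 ^ c)).filter (fun T₀ => (p * T₀ / 2 ^ c, q * T₀ / 2 ^ c) = κ),
              |g (p * T₀ / 2 ^ c, q * T₀ / 2 ^ c) T₀| :=
          (Finset.sum_fiberwise_of_maps_to hmaps _).symm
      _ ≤ ∑ κ ∈ range p ×ˢ range q, (2 : ℝ) ^ c * Tm * τ / (2 * (B : ℝ) ^ 2) :=
          Finset.sum_le_sum (fun κ _ => hclass κ)
      _ = _ := by
          rw [Finset.sum_const, Finset.card_product, Finset.card_range, Finset.card_range, nsmul_eq_mul]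
  -- conclusion
  have hblocks := abs_sum_Icc_le_blocks F hF1 (show 0 < 2 ^ c by positivity) M
  have hpq : ((p * q : ℕ) : ℝ) ≤ (B : ℝ) ^ 2 := by
    have : p * q ≤ B * B := Nat.mul_le_mul hpB hqB
    have : ((p * q : ℕ) : ℝ) ≤ ((B * B : ℕ) : ℝ) := by exact_mod_cast this
    simpa [sq] using this
  have hS : |∑ m ∈ Icc 1 M, F m| ≤
      |∑ T ∈ range Tm, ∑ T₀ ∈ range (2 ^ c), F (2 ^ c * T + T₀)| + (2 : ℝ) ^ c + 1 := by
    have := hblocks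
    push_cast at this
    exact this
  exact numeric_final hBpos hτ hL1 (Nat.cast_nonneg Tm) hS hmain hpq hLTm hLD hτD hD
end Summit.QuantumAdvantage.QuantumAdvantage.Theorems.MobiusLadderQuadraticDigitPhasesStubOneCutKatai
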